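import Summits.CriticalPhenomena.PercolationContinuityZ3.Theorems.Transplant.SkelPhiWinChainF
import Summits.CriticalPhenomena.PercolationContinuityZ3.Theorems.Transplant.SkelRouteLaw
import Summits.CriticalPhenomena.PercolationContinuityZ3.Theorems.Transplant.SkelPhiConcExcess
import Summits.CriticalPhenomena.PercolationContinuityZ3.Theorems.Transplant.SkelConcFaceRoute
import HarnessLib

/-!
# N1 ({±1} node), (F) inner route, part R1 (hp-8 g33): THE ROUTE LAW OF A SCHEDULE-FRAME CHAIN ABOUT A WIRED SEED — under hp-8 g24's
# `Skel.routeW G Wt Qt S` (the face-step law `Wt`, a subbox weighting of `winGraph G w₀ R` on the face-step region `Rg`, with the kit's seed `S`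
# WIRED, cut to a route world `Qt ⊆ Rg`), the region windows `𝒲.stepDF Sch k` of ANY schedule frame `Sch : ChainPlanar.SchedFrame` read through
# the plain windows `𝒲 = planarWindowWin hlipψ c L` of ANY Lipschitz map `ψ` (bridge frame `rootFrame φ c σ`, band frame `runX φ c …`) that lie in `Qt`
# and miss `S` are subboxes of the route law in the inner window graph `winGraph G c L`; the rim part of such a region beyond depth `L − L'` from `c`
# has excess `≤ η` under the route law (centre-uniform excess radius); N1 twin of hp-8 g30's `SkelPhiConcFaceRoute` §1–§2 over `SchedFrame`

builds on p205010 (kernel theorem, internal audit signed; external expert review pending) — nothing in this file uses p205010; nothing here is a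
claim about the open node `SamePDropOfSkeletonNeg`.
Lane `prim-bschramm`, seat `prim-hp-8` (gen 33); helper file (`--supports stmt-CriticalPhenomena-4575 --as helper`).  The Φ-free law facts
`Skel.routeW / isSubbox_routeW / finSupp_routeW` (SkelRouteLaw) and the φ-level `Skelφ.real_rim_le_of_wired_source` (SkelPhiConcExcess) are IMPORTED.
* §1 `stepDF_win_subset_ball`, **`isSubbox_routeW_stepDF`**, `finSupp_routeW'`;
* §2 `rimF` (the rim part of a region window beyond depth `r₁` from the inner centre), `rimF_subset_stepDF`, **`real_rimF_routeW_le`**.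
[cite: KozmaNitzan2024, §4 p. 17 (subbox), Lemma 11 (p. 22: Ω minus the wired cube), Lemma 12 (p. 24)] [cite: MartineauSevero2019, Cor. 2.2]
-/

noncomputable section

open MeasureTheory
open scoped Classical

namespace Summit.CriticalPhenomena.PercolationContinuityZ3.Theorems.Transplant

namespace Skelφ

open Literature.Probability.Percolation Literature.Probability.LatticeModels SimpleGraph KNLevels ChainPlanar
open Literature.Barriers.CriticalPhenomena (graphBall graphBall_mono)
open Skel (winGraph routeW excess)

variable {V : Type} [DecidableEq V] {G : SimpleGraph V} [G.LocallyFinite] {ψ : V → Site 2}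

/-! ## §1 Region windows of a schedule frame are subboxes of the route law -/

section Law

variable (hlipψ : Lip G ψ) (c : V) (L : ℕ) (Sch : SchedFrame)

/-- Region windows of the plain window family lie in the inner ball. [folklore] -/
theorem stepDF_win_subset_ball (k : ℕ) : ∀ u ∈ (planarWindowWin hlipψ c L).stepDF Sch k, u ∈ graphBall G c L :=
  fun _ hu => ((mem_Win G ψ).1 hu).1

variable {c L Sch}
variable {w₀ : V} {R : ℕ} {Wt : Sym2 V → unitInterval} {q : unitInterval} {Rg Qt S : Finset V}

/-- **A region window `stepDF k` inside the route world and missing the wired seed is a subbox of the route law `routeW Wt Qt S` in the inner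
window graph `winGraph G c L`** (`Wt` a subbox weighting of `winGraph G w₀ R` on `Rg ⊆ B_G(w₀, R)`, `Qt ⊆ Rg`, `Wt` vanishing off `G`).
[cite: KozmaNitzan2024, §4 p. 17 (subbox), Lemma 11 (p. 22: Ω minus the wired cube)] -/
theorem isSubbox_routeW_stepDF (hWG : ∀ e, e ∉ G.edgeSet → Wt e = 0) (hWD : IsSubbox (winGraph G w₀ R) Wt q Rg)
    (hRg : ∀ u ∈ Rg, u ∈ graphBall G w₀ R) (hQ : Qt ⊆ Rg) (hQL : ∀ u ∈ Qt, u ∈ graphBall G c L) {k : ℕ}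
    (hDQ : (planarWindowWin hlipψ c L).stepDF Sch k ⊆ Qt) (hSD : Disjoint S ((planarWindowWin hlipψ c L).stepDF Sch k)) :
    IsSubbox (winGraph G c L) (routeW G Wt Qt S) q ((planarWindowWin hlipψ c L).stepDF Sch k) :=
  Skel.isSubbox_routeW G hWG hDQ hQL (fun u hu => hRg u (hQ (hDQ hu))) hSD (hWD.anti (hDQ.trans hQ))

/-- The route law is supported on any finite set containing the route world. [folklore] -/
theorem finSupp_routeW' {Sfin : Finset V} (hQS : Qt ⊆ Sfin) : FinSupp (routeW G Wt Qt S) Sfin := by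
  refine ⟨fun e he => (Skel.finSupp_routeW G Wt Qt S).zero e ?_⟩
  obtain ⟨x, hx, hxS⟩ := he
  exact ⟨x, hx, fun hxQ => hxS (hQS hxQ)⟩

/-! ## §2 The rim part of a region window and its excess under the route law -/

variable (c L Sch)

/-- **The rim part of the region window of step `k`**: its vertices beyond depth `r₁` from the inner centre `c`. [this work] -/
def rimF (r₁ k : ℕ) : Finset V := ((planarWindowWin hlipψ c L).stepDF Sch k).filter fun v => v ∉ graphBall G c r₁

/-- The rim part lies in the region window. [folklore] -/
theorem rimF_subset_stepDF (r₁ k : ℕ) : rimF hlipψ c L Sch r₁ k ⊆ (planarWindowWin hlipψ c L).stepDF Sch k := Finset.filter_subset _ _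

variable {c L Sch}

/-- **The rim excess of step `k` under the route law is `≤ η`**: the route world `Qt ⊆ Rg` (inside `B_G(c, L)`, of planar `φ`-diameter `m`), the wired
seed `S ∋ o` in `Qt` within graph distance `R₀'` of `c` and off the region window, `R₁ ≤ r₁` a centre-uniform excess radius at the running parameter
for the planar map `φ`, entrance depth `R₀'`, diameter `m` ⟹ `P_{routeW}(⋃_{z ∈ rimF r₁ k} o ↔ z) ≤ η`.
[cite: KozmaNitzan2024, §4 Lemma 11 (p. 22), Lemma 12 (p. 24)] [cite: MartineauSevero2019, Cor. 2.2] -/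
theorem real_rimF_routeW_le [Countable V] {φ : V → Site 2} (hWD : IsSubbox (winGraph G w₀ R) Wt q Rg) (hRg : ∀ u ∈ Rg, u ∈ graphBall G w₀ R)
    (hQ : Qt ⊆ Rg) (hQL : ∀ u ∈ Qt, u ∈ graphBall G c L) {m : ℕ} (hQm : ∀ d ∈ Qt, ∀ d' ∈ Qt, φ d - φ d' ∈ box 2 m)
    (hSQ : S ⊆ Qt) {o : V} (ho : o ∈ S) {R₀' : ℕ} (hnear : ∀ s ∈ S, s ∈ graphBall G c R₀') {η : ℝ} {R₁ r₁ : ℕ}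
    (hR₁ : ∀ (c' : V) (R'' : ℕ), R₁ ≤ R'' → ∀ (Rw : ℕ) (D' A' : Finset V), (∀ d ∈ D', d ∈ graphBall G c' Rw) →
      (∀ d ∈ D', ∀ d' ∈ D', φ d - φ d' ∈ box 2 m) → A' ⊆ D' → (∀ a ∈ A', a ∈ graphBall G c' R₀') →
        (bondPercolation G q).real (excess G c' R'' D' A') ≤ η)
    (hR : R₁ ≤ r₁) {k : ℕ} (hDQ : (planarWindowWin hlipψ c L).stepDF Sch k ⊆ Qt)
    (hSD : Disjoint S ((planarWindowWin hlipψ c L).stepDF Sch k)) :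
    (prodBernoulli (routeW G Wt Qt S)).real (⋃ z ∈ rimF hlipψ c L Sch r₁ k, openConn o z) ≤ η := by
  have hRimD := rimF_subset_stepDF hlipψ c L Sch r₁ k
  have key := real_rim_le_of_wired_source (hWD.anti hQ) (fun u hu => hRg u (hQ hu)) hSQ (hRimD.trans hDQ) (hSD.mono_right hRimD) ho
    (c := c) (r₁ := r₁) (fun t ht => (Finset.mem_filter.1 ht).2) hnear hR₁ hR (Rw := L) hQL hQm
    (F₀ := ↑(edgesIn G S)) (Skel.coe_edgesIn_subset_wireSet G S) ↑(edgesIn G S)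
  unfold Skel.routeW
  exact key

end Law

end Skelφ

end Summit.CriticalPhenomena.PercolationContinuityZ3.Theorems.Transplant

end
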